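import Summits.FinalStateConjecture.FinalStateConjecture.Theses.ZeroEnergyKerrOrBomb
import Literature.Geometry.Lorentzian.KillingModeStability
import Literature.Geometry.Lorentzian.StationaryFinalStateDecomposition
import Literature.Geometry.Lorentzian.LateTimeOmegaLimitSet
import Literature.Geometry.Lorentzian.KerrDataProofs
import Literature.Geometry.Lorentzian.KerrSchildCoord
-- scratch check against the landed Negative lemma of this crux (cdisprove cycle 1, p72863): it records the
-- SHAPE of a kill (`KerrOrBomb ∧ ¬FSC`, uniform failure of the summit property on one slice); no stub below
-- is an instance of it (no stub asserts the target, none denies the summit property anywhere).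
import Summits.FinalStateConjecture.FinalStateConjecture.Theorems.StationaryLimitReduction.Negative.KillShape

/-!
# Line `kerr-avoidance-dichotomy` for crux `ZeroEnergyKerrOrBomb.StationaryLimitReduction`
# (stmt-FinalStateConjecture-10021)

Skeleton (crux-plan, planner-cruxplan-stmt-FinalStateConjecture-10021-kerr-avoidance-dicho-0, 2026-08-16).
Direction POSITIVE. Line card: `Lines/kerr-avoidance-dichotomy.md`.

The crux is literally `KerrOrBomb → FinalStateConjecture` (`Disproof.crux_iff`; the standing disprover shows no
`_false_without_` theorem can exist: `Disproof.without_iff_summit`). The idea card (merged by the panel with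
`bombs-open-kerr-isolated`): read an MGHD through fixed late-time near-zone charts; its late-time ω-limit
("cluster") set of charted stationary holes is, hole by hole, CONNECTED (Hale) and compact; Kerr is ISOLATED
among admissible stationary vacuum holes (Alexakis–Ionescu–Klainerman perturbative rigidity made pointwise on an
anchored horizon collar), so "is Kerr" is relatively CLOPEN on the cluster set and each hole component is either
entirely Kerr (branch A: the development converges to the sub-extremal Kerr FAMILY at every accuracy — only
parameter pinning is left, no Kerr-stability theorem) or entirely non-Kerr (branch B: KERR-AVOIDING). `KerrOrBomb`
is consumed exactly once, on branch B, by contraposition (`bombLimited_of_kerrAvoiding`, PROVED): the cluster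
holes of a Kerr-avoiding tame development are scalar black-hole bombs, and the ejection engine makes the datum
Christodoulou-escapable. Christodoulou curve-genericity is not `∧`-closed (`Disproof.genericity_not_and_closed`),
so every escape below is ONE admissible curve into the class `Tame ∖ KerrAvoiding`, which the dichotomy plus
capture show to consist of GOOD data (`good_of_tame_of_not_kerrAvoiding`, PROVED); the imported architecture
(weak cosmic censorship, late compactness, Liouville, generic third law) therefore enters in the same escaping
form (`stub_wildAvoidable`) and never as a conjunction of generic clauses.

THE LINE (five registered stubs; the currency is the hypothesis structure `LateFrame` — a
`FinalStateDecompositionOver`-shaped late description of an MGHD WITHOUT any convergence clause — and its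
cluster sets `LateFrame.cluster i ⊆ ChartedHole`, the `seqOmegaLimit` of `C³`-convergence on every truncated
rest-frame slab `{tᵢ = T_n + s, rᵢ ≤ R}` of the hole chart's pulled-back metric to the adapted-chart profile
`φ^* g_𝓑` of a charted stationary hole `(𝓑, φ)`):

* `stub_wildAvoidable` — IMPORTED ARCHITECTURE in Christodoulou's escaping form: an admissible datum which is
  NOT tame (no MGHD, or an MGHD with incomplete `𝓘⁺`, or without a tame late frame: no late sequential
  compactness / a non-stationary or non-telescope ω-limit, e.g. extremal creep) lies on an admissible curve all
  of whose other members are tame and not Kerr-avoiding. NOT this line's mechanism; shared content with the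
  pool's censorship / shadowing / third-law cruxes (line card).
* `stub_kerrIsolation` — THE LEVER, first half (card's `UniformKerrIsolation`, retyped per triage): pointwise in
  sub-extremal `(M, a)` and a collar radius `r₀ ∈ (r₋, r₊)` there are `ε > 0` and ONE slab radius `R` such that a
  telescope hole whose metric, pulled back by a smooth injective `T`-equivariant collar chart
  `Ψ : {r > r₀} → 𝓑` ANCHORED by `Ψ({r > r₊}) = d.o.c.`, is `ε`-close in `C³` to `g_{M,a}` on `{t* = 0, r ≤ R}`,
  is (fact-free) isometric to SOME sub-extremal Kerr exterior.
* `stub_dichotomy` — THE LEVER, second half (the clopen transfer at slab level): given `KerrIsolation`, for a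
  tame late frame every cluster component is all-Kerr or all-non-Kerr (Hale connectedness of ω-limit sets of a
  continuous precompact curve + closedness of the Kerr locus among telescope holes + the isolation ⇒ open;
  `IsPreconnected.subset_or_subset`).
* `stub_capture` — branch A: all cluster holes Kerr ⇒ the summit's settled conjunct (an honest exhaustive
  sub-extremal `FinalStateDecomposition` with `O = exteriorOf`): compactness ⇒ parameters in a compact
  sub-extremal set and eventual closeness at every accuracy; PARAMETER PINNING along the connected Kerr-valued
  cluster continuum; Kerr-chart transfer to Kerr–Schild gauge; `C³ ⇒ C²`.
* `stub_ejection` — branch B (HARDEST): a bomb-limited datum is escapable into `Tame ∖ KerrAvoiding`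
  (uniform rate `ν₁ ≥ ν₀ > 0` on the compact cluster set by spectral persistence = card 4's B1; Moncrief /
  symplectic transversality of a compactly supported VACUUM kick = card `symplectic-dual-of-the-bomb`; locked
  strong-unstable ejection = card `one-locked-explosion`; fate of the ejected curve; the scalar→tensor Bridge of
  `Disproof` §6 note 1).

Composition (sorry-free): `finalStateConjecture_of : KerrOrBomb → S1 → … → S5 → FinalStateConjecture` and
`StationaryLimitReduction_of : S1 → … → S5 → StationaryLimitReduction` (the crux BY NAME).

Disproof.lean honoured (cdisprove cycle 1, rev 3, read in full): §1/§2 — no `_false_without_` exists; the line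
localises the USE of `KerrOrBomb` to `bombLimited_of_kerrAvoiding`; §5 — one curve per bad datum into
`Tame ∖ KerrAvoiding` (`Escapable`), never an intersection of generic clauses; §6 note 1 (scalar proxy) — carried
inside `stub_ejection` (named in its docstring), note 2 (extremal limits) — degenerate cluster holes are NOT
telescope holes, so such data are non-tame and go to `stub_wildAvoidable` (the generic third law, imported),
note 3 (D-h3, global horizon Killing field in `IsNonDegenerateHorizon`) — `IsTame.telescope` asks it of the
LIMIT hole, i.e. Hawking rigidity of the limit is an imported cost of tameness until the collar-form restate of
h3 lands (line card, Triage answers). Landed Negative lemma `Negative/KillShape.lean`: imported above; no stub is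
an instance. Negatives index (`ledger negatives --problem FinalStateConjecture`): empty.
-/

set_option linter.dupNamespace false
set_option linter.unusedVariables false

noncomputable section

namespace Summit.FinalStateConjecture.FinalStateConjecture.Cruxes.StationaryLimitReduction.KerrAvoidanceDichotomy

open Summit.FinalStateConjecture.FinalStateConjecture.Theses.ZeroEnergyKerrOrBomb
open Literature.Geometry.Lorentzian
open scoped Manifold ContDiff Topology ENNReal NNReal
open Filter Set Function TopologicalSpace

/-- `Kerr.Facts` is inhabited (its three fields are theorems of the tree: `KerrDataProofs.lean`,
`KerrSchildCoord.lean`); every Kerr-chart notion below (in particular `Kerr.smoothMetric` inside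
`IsKerrExterior`, and the instance argument of `KerrOrBomb`) uses this instance — a `Prop`, so the choice is
definitionally irrelevant. [folklore] -/
instance instKerrFacts : Kerr.Facts :=
  ⟨Kerr.isConnected_region_holds, Kerr.contMDiff_bilin_holds, Kerr.contMDiff_timeVector_holds⟩

/-! ## §0 The summit unfolded -/

section Summit

variable (X : Type) [TopologicalSpace X] [ChartedSpace E3 X] [IsManifold (𝓡 3) ∞ X] [ConnectedSpace X]

/-- **The summit property of an admissible datum** (verbatim the lambda of `FinalStateConjecture`; also the
standing disprover's `Disproof.SummitProperty`): an MGHD exists, and every MGHD has complete `𝓘⁺` and an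
exhaustive sub-extremal `N`-Kerr final-state decomposition of its self-determined exterior.
[cite: DafermosLuk2017, Conjecture 1 and §1.2.1] -/
def Good (D : InitialDataSet (𝓡 3) X) : Prop :=
  (∃ 𝒟 : VacuumCauchyDevelopment D, 𝒟.IsMaximal) ∧
    ∀ 𝒟 : VacuumCauchyDevelopment D, 𝒟.IsMaximal →
      Summit.FinalStateConjecture.HasCompleteNullInfinity 𝒟.toCauchyDevelopment ∧
        ∃ (O : Set 𝒟.carrier) (d : FinalStateDecomposition 𝒟.toSpacetime O 2),
          (∀ i, Kerr.IsSubextremal (d.mass i) (d.spin i)) ∧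
            O = Summit.FinalStateConjecture.exteriorOf 𝒟.toCauchyDevelopment d.charted ∧
              Summit.FinalStateConjecture.HasExhaustiveCharts d

end Summit

/-- The summit IS Christodoulou-genericity (codimension `1`) of `Good` in the admissible class, on every slice.
[folklore] -/
theorem summit_iff :
    _root_.FinalStateConjecture ↔
      ∀ (X : Type) [TopologicalSpace X] [ChartedSpace E3 X] [IsManifold (𝓡 3) ∞ X] [T2Space X]
        [SecondCountableTopology X] [ConnectedSpace X],
        InitialDataSet.IsChristodoulouGeneric (admissibleVacuumData X) (Good X) 1 :=
  Iff.rfl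

/-! ## §1 Vocabulary: admissible stationary holes and their charted profiles -/

/-- **`𝓑` meets the telescope of `KerrOrBomb`** (verbatim its five hypotheses, under the standing Levi-Civita
instance): vacuum, connected future event horizon, non-degenerate horizon (as typed: a GLOBAL Killing field
nowhere zero on `𝓔⁺` with `∇_K K = κK`, `κ ≠ 0` — Disproof §6 note 3 / D-h3), globally hyperbolic carrier, and
stationary field nowhere zero on the d.o.c. [cite: ChruscielCosta2008, §1 and §2.4–2.5] -/
def IsTelescopeHole (𝓑 : StationaryAFBlackHole.{0}) : Prop :=
  ∀ [𝓑.metric.HasLeviCivita],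
    𝓑.metric.toPseudoRiemannianMetric.IsRicciFlat ∧ IsConnected 𝓑.horizon ∧
      𝓑.toSpacetime.IsNonDegenerateHorizon 𝓑.Mext ∧ 𝓑.metric.IsGloballyHyperbolic 𝓑.timeOrientation ∧
        ∀ p ∈ 𝓑.doc, 𝓑.killing p ≠ 0

/-- **`𝓑` is a sub-extremal Kerr exterior, fact-free form** — VERBATIM the conclusion of `KerrOrBomb` (rev 4):
there are `|a| < M` and a smooth injective isometric immersion of the ingoing Kerr–Schild exterior chart
`(Kerr.exterior M a, g_{M,a})` into `𝓑` with range exactly the d.o.c. [cite: ChruscielCosta2008, Thm. 1.3] -/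
def IsKerrExterior (𝓑 : StationaryAFBlackHole.{0}) : Prop :=
  ∃ (M a : ℝ), Kerr.IsSubextremal M a ∧ ∃ Ψ : Kerr.exterior M a → 𝓑.carrier,
    Function.Injective Ψ ∧ Set.range Ψ = 𝓑.doc ∧
      PseudoRiemannianMetric.IsIsometricImmersion
        (Kerr.smoothMetric M a (Kerr.rPlus M a)).toPseudoRiemannianMetric 𝓑.metric.toPseudoRiemannianMetric Ψ

/-- **A charted stationary hole** (the points of the cluster sets): a stationary asymptotically flat black hole
`𝓑` together with a `T`-adapted chart `φ : U → 𝓑` (`StationaryAFBlackHole.AdaptedChart`: time = Killing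
parameter, `U` time-translation invariant, `φ(U) ⊇ d.o.c.`, `φ(U) ⊆ I⁺(M_ext)`, the profile `φ^* g_𝓑` carried
as the total function `adapted.bilin`). [cite: AlexakisIonescuKlainerman2009, §1.1 assumption GR] -/
structure ChartedHole where
  /-- The stationary black hole. -/
  hole : StationaryAFBlackHole.{0}
  /-- Its `T`-adapted chart. -/
  adapted : hole.AdaptedChart

/-- **The anchored Kerr collar background** `({r > r₀}, g_{M,a}, t*, r)` in ingoing Kerr–Schild coordinates on
the horizon-penetrating domain `Kerr.region a r₀` (for `r₋ < r₀ < r₊` it contains a collar across `𝓗⁺`), in the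
format of `KerrConvergence.lean` (`Kerr.background M a` is the case `r₀ = r₊`). [cite: arXiv08110354, §5.1] -/
def kerrCollarBackground (M a r₀ : ℝ) : ModelBackground :=
  ⟨Kerr.region a r₀, Kerr.bilin M a, fun x ↦ x 0, Kerr.radius a⟩

/-! ## §2 Vocabulary: late frames of a spacetime and their cluster (ω-limit) sets -/

/-- **Static data of one hole chart**: a rest-frame coordinate domain `U ⊆ E4` (time-translation invariant),
a time-independent rest-frame radius function `r`, and the asymptotic Poincaré motion `(Λ, c)` of the hole
(as the motions of `FinalStateDecomposition`). [cite: DafermosLuk2017, §1.2.1] -/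
structure HoleFrame where
  /-- The rest-frame chart domain. -/
  U : Opens E4
  /-- The rest-frame radius function. -/
  r : E4 → ℝ
  /-- The Lorentz part of the motion. -/
  Λ : lorentzGroup
  /-- The translation part of the motion. -/
  c : E4
  /-- `U` is invariant under time translations. -/
  mem_U_ofTimeSpace : ∀ (t t' : ℝ) (y : E3), E4.ofTimeSpace t y ∈ U → E4.ofTimeSpace t' y ∈ U
  /-- `r` is time independent. -/
  r_ofTimeSpace : ∀ (t : ℝ) (y : E3), r (E4.ofTimeSpace t y) = r (E4.ofTimeSpace 0 y)

namespace HoleFrame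

variable (H : HoleFrame)

/-- Rest-frame coordinates `Λ⁻¹(x − c)` of the moving chart. [cite: DafermosLuk2017, §1.2.1] -/
def restCoord (x : E4) : E4 := poincareInv H.Λ H.c x

/-- The moved chart domain `{x | Λ⁻¹(x − c) ∈ U}`. [cite: DafermosLuk2017, §1.2.1] -/
def domain : Opens E4 :=
  ⟨H.restCoord ⁻¹' (H.U : Set E4), H.U.isOpen.preimage (continuous_poincareInv H.Λ H.c)⟩

/-- Rest-frame chart time. [cite: DafermosLuk2017, §1.2.1] -/
def time (x : E4) : ℝ := H.restCoord x 0

/-- Rest-frame radius. [cite: DafermosLuk2017, §1.2.1] -/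
def radius (x : E4) : ℝ := H.r (H.restCoord x)

/-- **The reference background of the hole chart with profile `b`**: the rest-frame background
`(U, b, x⁰, r)` moved by `(Λ, c)` — written out so that its domain is `H.domain` syntactically for every `b`
(`bg_eq_boost`: it IS `ModelBackground.boost`). The frame clauses use `b = 0` (they only read domain, time and
radius); cluster profiles use `b = φ^* g_𝓑`. [cite: DafermosLuk2017, §1.2.1] -/
def bg (b : E4 → E4 →L[ℝ] E4 →L[ℝ] ℝ) : ModelBackground where
  domain := H.domain
  bilin x := (ContinuousLinearMap.precomp ℝ ((H.Λ : E4 ≃L[ℝ] E4).symm : E4 →L[ℝ] E4)).comp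
    ((b (H.restCoord x)).comp ((H.Λ : E4 ≃L[ℝ] E4).symm : E4 →L[ℝ] E4))
  time := H.time
  radius := H.radius

/-- `H.bg b` is the rest-frame background `(U, b, x⁰, r)` moved by `(Λ, c)` (definitional). [folklore] -/
theorem bg_eq_boost (b : E4 → E4 →L[ℝ] E4 →L[ℝ] ℝ) :
    H.bg b = (⟨H.U, b, fun x ↦ x 0, H.r⟩ : ModelBackground).boost H.Λ H.c :=
  rfl

/-- The domain of `H.bg b` does not depend on the profile. [folklore] -/
@[simp] theorem bg_domain (b : E4 → E4 →L[ℝ] E4 →L[ℝ] ℝ) : (H.bg b).domain = H.domain := rfl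

end HoleFrame

/-- **A late frame of the region `O` of the spacetime `𝓢`**: the data and the GEOMETRIC clauses of an
`N`-hole `FinalStateDecompositionOver` (`StationaryFinalStateDecomposition.lean`) — `N` moving hole charts on
fixed rest-frame domains, all `IsLateChart` into `O` after `τ₀`, separating truncated world-tubes, sublinear
excision tubes, a flat radiation-zone chart converging to `η` in `C³`, one global covering clause — with the
near-zone CONVERGENCE clause deleted: nothing is said about what the hole charts' pulled-back metrics do at
late times; that is read off through the cluster sets `LateFrame.cluster`. [cite: DafermosLuk2017, §1.2.1] -/
structure LateFrame (𝓢 : Spacetime.{0} 4) (O : Set 𝓢.carrier) where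
  /-- The number of hole charts. -/
  N : ℕ
  /-- The static data of the hole charts. -/
  hole : Fin N → HoleFrame
  /-- The common initial late time of all charts. -/
  τ₀ : ℝ
  /-- The hole charts (fixed once and for all; late-time limits are taken along their time translates). -/
  chart : ∀ i, ((hole i).bg 0).domain → 𝓢.carrier
  /-- Each hole chart is a late-time chart into `O` after `τ₀`. -/
  isLateChart : ∀ i, 𝓢.IsLateChart ((hole i).bg 0) O τ₀ (chart i)
  /-- The truncated world-tubes separate. -/
  exists_pairwise_disjoint : ∀ R : ℝ, ∃ τ₁ : ℝ,
    Pairwise (Function.onFun Disjoint fun i ↦ chart i '' ((hole i).bg 0).truncLateRegion τ₁ R)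
  /-- The excision radii of the near-zone tubes in the flat chart. -/
  excision : Fin N → ℝ → ℝ
  /-- The excision radii grow sublinearly. -/
  tendsto_excision_div : ∀ i, Tendsto (fun t ↦ excision i t / t) atTop (𝓝 0)
  /-- The flat (radiation-zone) chart domain. -/
  flatDomain : Opens E4
  /-- The flat domain contains the late half-space minus the excised tubes around the holes' world-lines. -/
  setOf_lt_excision_subset_flatDomain :
    {x : E4 | τ₀ < x 0 ∧ ∀ i, excision i (x 0) < ((hole i).bg 0).radius x} ⊆ flatDomain
  /-- The flat chart. -/
  flatChart : flatDomain → 𝓢.carrier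
  /-- The flat chart is a late-time chart into `O` after `τ₀`. -/
  isLateChart_flat : 𝓢.IsLateChart (Minkowski.backgroundOn flatDomain) O τ₀ flatChart
  /-- Radiation zone: full `C³` convergence to `η` on the flat slabs. -/
  tendsto_deviationCk_flat :
    Tendsto (fun τ ↦ 𝓢.deviationCk (Minkowski.backgroundOn flatDomain) flatChart 3 τ) atTop (𝓝 0)
  /-- Global covering clause at `τ₀`. -/
  diff_subset_causalPast :
    O \ ((⋃ i, chart i '' ((hole i).bg 0).lateRegion τ₀) ∪
        flatChart '' (Minkowski.backgroundOn flatDomain).lateRegion τ₀) ⊆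
      𝓢.metric.causalPast 𝓢.timeOrientation
        ((⋃ i, chart i '' ((hole i).bg 0).timeSlab τ₀) ∪
          flatChart '' (Minkowski.backgroundOn flatDomain).timeSlab τ₀)

namespace LateFrame

variable {𝓢 : Spacetime.{0} 4} {O : Set 𝓢.carrier} (F : LateFrame 𝓢 O)

/-- The frame background of hole `i` (profile `0`: only domain, time, radius are read). [folklore] -/
abbrev bg₀ (i : Fin F.N) : ModelBackground := (F.hole i).bg 0

/-- The black-hole region of hole `i`: the image of the late rest-frame domain `{tᵢ > τ₀}`. [cite: Klainerman2025, §1.1.1] -/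
def region (i : Fin F.N) : Set 𝓢.carrier := F.chart i '' (F.bg₀ i).lateRegion F.τ₀

/-- The radiation zone. [cite: Klainerman2025, §1.1.1] -/
def radiationZone : Set 𝓢.carrier :=
  F.flatChart '' (Minkowski.backgroundOn F.flatDomain).lateRegion F.τ₀

/-- The charted late region (the shape of `FinalStateDecomposition.charted`). [cite: Klainerman2025, §1.1.1] -/
def charted : Set 𝓢.carrier := F.radiationZone ∪ ⋃ i, F.region i

/-- The certified late region after `τ₁` for growing near-zone radii `R` (shape of the summit's
`certifiedLate`). [cite: DafermosLuk2017, Conjecture 1 (b)] -/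
def certifiedLate (R : Fin F.N → ℝ → ℝ) (τ₁ : ℝ) : Set 𝓢.carrier :=
  F.flatChart '' (Minkowski.backgroundOn F.flatDomain).lateRegion τ₁ ∪
    ⋃ i, F.chart i '' {x | τ₁ < (F.bg₀ i).time x.1 ∧ (F.bg₀ i).radius x.1 ≤ R i ((F.bg₀ i).time x.1)}

/-- The certified slab at `τ₁` (shape of the summit's `certifiedSlab`). [cite: DafermosLuk2017, Conjecture 1 (b)] -/
def certifiedSlab (R : Fin F.N → ℝ → ℝ) (τ₁ : ℝ) : Set 𝓢.carrier :=
  F.flatChart '' (Minkowski.backgroundOn F.flatDomain).timeSlab τ₁ ∪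
    ⋃ i, F.chart i '' (F.bg₀ i).truncTimeSlab (R i τ₁) τ₁

/-- The charted hole `p` is **compatible with hole chart `i`**: its adapted chart lives on the rest-frame domain
`Uᵢ` with the rest-frame radius `rᵢ` (so truncated slabs match). [folklore] -/
def IsCompatible (i : Fin F.N) (p : ChartedHole) : Prop :=
  p.adapted.domain = (F.hole i).U ∧ p.adapted.radius = (F.hole i).r

/-- **Convergence of the translates to a profile**: along the time sequence `T`, the `C³` deviation of the hole
chart's pulled-back metric from the moved profile `φ^* g_𝓑` tends to `0` on EVERY truncated rest-frame slab
`{tᵢ = T n + s, rᵢ ≤ R}` — locally uniform `C³` convergence of the translated chart metrics to the stationary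
profile, including whatever horizon collar the domain `Uᵢ` carries (the card's "`C³_loc`-with-collar"
convergence; Hale 1980 Ch. I §8; Lott 2018 §2.1). [cite: Hale1980, Ch. I §8] [cite: Lott2018, §2.1] -/
def ConvergesAlong (i : Fin F.N) (p : ChartedHole) (T : ℕ → ℝ) : Prop :=
  ∀ R s : ℝ, Tendsto (fun n ↦ 𝓢.truncDeviationCk ((F.hole i).bg p.adapted.bilin) (F.chart i) 3 R (T n + s))
    atTop (𝓝 0)

/-- **The cluster set of hole `i`** (late-time ω-limit set in the sense of `LateTimeOmegaLimitSet.lean`): the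
compatible charted stationary holes which are limits of the translates along SOME sequence of times
`T_n → +∞` — `seqOmegaLimit` of the convergence relation `ConvergesAlong` along the time curve.
[cite: Hale1980, Ch. I §8] -/
def cluster (i : Fin F.N) : Set ChartedHole :=
  {p | F.IsCompatible i p} ∩ seqOmegaLimit (fun (T : ℕ → ℝ) (p : ChartedHole) ↦ F.ConvergesAlong i p T) id

/-- Membership in the cluster set. [cite: Hale1980, Ch. I §8] -/
theorem mem_cluster_iff {i : Fin F.N} {p : ChartedHole} :
    p ∈ F.cluster i ↔ F.IsCompatible i p ∧ ∃ T : ℕ → ℝ, Tendsto T atTop atTop ∧ F.ConvergesAlong i p T :=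
  Iff.rfl

section Tame

variable {X : Type} [TopologicalSpace X] [ChartedSpace E3 X] [IsManifold (𝓡 3) ∞ X] [ConnectedSpace X]
  {D : InitialDataSet (𝓡 3) X}

/-- **The late frame `F` of the MGHD `𝒟` is TAME** — the imported architecture, stated as the OUTPUT of the soft
ω-limit theory plus the Liouville and third-law inputs, i.e. exactly what the clopen step consumes:
* `exterior_eq`: `O` is the self-determined exterior `J⁺(ι X) ∩ I⁻(charted)` (the summit's `exteriorOf`);
* `subseq` (LATE SEQUENTIAL COMPACTNESS + IDENTIFICATION): every sequence of times `T_n → ∞` has a subsequence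
  along which hole `i`'s translates converge, on every truncated slab in `C³`, to a COMPATIBLE CHARTED
  STATIONARY HOLE (orbital boundedness ⇒ Arzelà–Ascoli; eternal + news-free + tame ⇒ stationary: the pool's
  Liouville input; the limit components ARE an adapted-chart profile of a `StationaryAFBlackHole`, incl. its
  asymptotically flat end);
* `telescope`: every cluster hole meets the telescope of `KerrOrBomb` (vacuum — soft; ONE horizon component per
  chart — charts are taken per eventual horizon component; NON-DEGENERATE — the generic dynamical third law,
  degenerate limits being non-tame by definition (Disproof §6 note 2); globally hyperbolic; `T = dφ(∂₀) ≠ 0` on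
  the d.o.c.) and its adapted chart REACHES ACROSS THE HORIZON (`𝓗⁺ ⊆ φ(U)`: a collar, as isolation needs);
* `exhaustive`: growing near-zone radii on which the translates still approach the cluster set, and the summit's
  causal exhaustiveness of the certified regions (verbatim the shape of `HasExhaustiveCharts`).
Nothing here mentions Kerr. [cite: DafermosLuk2017, §1.2.1] [cite: Hale1980, Ch. I §8 Thm. 8.1] -/
structure IsTame (𝒟 : VacuumCauchyDevelopment D) {O : Set 𝒟.carrier} (F : LateFrame 𝒟.toSpacetime O) : Prop where
  /-- `O` is the self-determined exterior of the charted late region. -/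
  exterior_eq : O = Summit.FinalStateConjecture.exteriorOf 𝒟.toCauchyDevelopment F.charted
  /-- Late sequential compactness with stationary identification of the limits. -/
  subseq : ∀ (i : Fin F.N) (T : ℕ → ℝ), Tendsto T atTop atTop →
    ∃ φ : ℕ → ℕ, StrictMono φ ∧ ∃ p : ChartedHole, F.IsCompatible i p ∧ F.ConvergesAlong i p (T ∘ φ)
  /-- Cluster holes meet the telescope and their charts carry a horizon collar. -/
  telescope : ∀ (i : Fin F.N), ∀ p ∈ F.cluster i, IsTelescopeHole p.hole ∧ p.hole.horizon ⊆ Set.range p.adapted.toFun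
  /-- Exhaustiveness with growing radii, in cluster form. -/
  exhaustive : ∃ R : Fin F.N → ℝ → ℝ,
    (∀ (i : Fin F.N) (ε : ℝ), 0 < ε → ∀ᶠ τ in atTop, ∃ p ∈ F.cluster i,
      𝒟.toSpacetime.truncDeviationCk ((F.hole i).bg p.adapted.bilin) (F.chart i) 3 (R i τ) τ ≤ ENNReal.ofReal ε) ∧
    ∀ τ₁ : ℝ, F.τ₀ < τ₁ →
      O \ F.certifiedLate R τ₁ ⊆ 𝒟.metric.causalPast 𝒟.timeOrientation (F.certifiedSlab R τ₁)

/-- **Anti-vacuity of the dichotomy**: the cluster sets of a tame frame are nonempty (take `T_n = n`). [folklore] -/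
theorem IsTame.cluster_nonempty {𝒟 : VacuumCauchyDevelopment D} {O : Set 𝒟.carrier}
    {F : LateFrame 𝒟.toSpacetime O} (hF : F.IsTame 𝒟) (i : Fin F.N) : (F.cluster i).Nonempty := by
  obtain ⟨φ, hφ, p, hp, hconv⟩ := hF.subseq i (fun n : ℕ ↦ (n : ℝ)) tendsto_natCast_atTop_atTop
  refine ⟨p, hp, (fun n : ℕ ↦ (n : ℝ)) ∘ φ, ?_, hconv⟩
  exact tendsto_natCast_atTop_atTop.comp hφ.tendsto_atTop

end Tame

end LateFrame

/-! ## §3 Vocabulary: the per-datum predicates of the dichotomy -/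

section Datum

variable (X : Type) [TopologicalSpace X] [ChartedSpace E3 X] [IsManifold (𝓡 3) ∞ X] [ConnectedSpace X]

/-- **Tame datum**: an MGHD exists, and every MGHD has complete `𝓘⁺` (weak cosmic censorship) and admits a tame
late frame of some region. [cite: Christodoulou1999, pp. A24–A27] -/
def Tame (D : InitialDataSet (𝓡 3) X) : Prop :=
  (∃ 𝒟 : VacuumCauchyDevelopment D, 𝒟.IsMaximal) ∧
    ∀ 𝒟 : VacuumCauchyDevelopment D, 𝒟.IsMaximal →
      Summit.FinalStateConjecture.HasCompleteNullInfinity 𝒟.toCauchyDevelopment ∧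
        ∃ (O : Set 𝒟.carrier) (F : LateFrame 𝒟.toSpacetime O), F.IsTame 𝒟

/-- **Kerr-avoiding datum** (branch B): some MGHD has a tame late frame one of whose cluster components consists
of holes NONE of which is a sub-extremal Kerr exterior ("eventually-and-forever away from every Kerr" on that
component; by `stub_dichotomy` the only alternative, per component, to "entirely Kerr"). [cite: AlexakisIonescuKlainerman2009, Thm. 1.1] -/
def KerrAvoiding (D : InitialDataSet (𝓡 3) X) : Prop :=
  ∃ 𝒟 : VacuumCauchyDevelopment D, 𝒟.IsMaximal ∧
    ∃ (O : Set 𝒟.carrier) (F : LateFrame 𝒟.toSpacetime O), F.IsTame 𝒟 ∧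
      ∃ i : Fin F.N, ∀ p ∈ F.cluster i, ¬ IsKerrExterior p.hole

/-- **Bomb-limited datum**: some MGHD has a tame late frame one of whose cluster components consists of holes
NONE of which is Killing-mode stable for `□_g` — the development idles forever, on that component, near a family
of scalar black-hole bombs (`StationaryAFBlackHole.IsKillingModeStable`, `KillingModeStability.lean`).
[cite: ShlapentokhRothman2015ModeStability, Def. 1.1 and §1.3] -/
def BombLimited (D : InitialDataSet (𝓡 3) X) : Prop :=
  ∃ 𝒟 : VacuumCauchyDevelopment D, 𝒟.IsMaximal ∧
    ∃ (O : Set 𝒟.carrier) (F : LateFrame 𝒟.toSpacetime O), F.IsTame 𝒟 ∧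
      ∃ i : Fin F.N, ∀ p ∈ F.cluster i, ∀ [p.hole.metric.HasLeviCivita], ¬ p.hole.IsKillingModeStable

/-- **Escapable datum** — the ONE-CURVE form forced by `Disproof.genericity_not_and_closed`: through `D` passes a
smooth injective one-parameter family of ADMISSIBLE data all of whose other members are tame and not
Kerr-avoiding (hence good, `good_of_tame_of_not_kerrAvoiding`). [cite: Christodoulou1999, p. A24] -/
def Escapable (D : InitialDataSet (𝓡 3) X) : Prop :=
  ∃ F : EuclideanSpace ℝ (Fin 1) → InitialDataSet (𝓡 3) X,
    InitialDataSet.IsSmoothDataFamily 1 F ∧ F 0 = D ∧ Function.Injective F ∧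
      (∀ c, F c ∈ admissibleVacuumData X) ∧ ∀ c, c ≠ 0 → Tame X (F c) ∧ ¬ KerrAvoiding X (F c)

end Datum

/-- **Kerr is isolated among telescope holes, at slab level, on an anchored collar chart** (the statement of
`stub_kerrIsolation`, named so that `stub_dichotomy` can take it as its hypothesis). Pointwise in sub-extremal
`(M, a)` and `r₋ < r₀ < r₊`: there are `ε > 0` and a slab radius `R > r₊` such that every telescope hole `𝓑`
admitting a smooth injective chart `Ψ` of the collar domain `{r > r₀}` which is `T`-EQUIVARIANT
(`dΨ(∂_{t*}) = T`), ANCHORED (`Ψ({r > r₊}) = ⟨⟨M_ext⟩⟩`, so the collar `{r₀ < r ≤ r₊}` sits across `𝓑`'s horizon)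
and along which `𝓑`'s metric is `ε`-close in `C³` to `g_{M,a}` on the one slab `{t* = 0, r ≤ R}`, is a
sub-extremal Kerr exterior (`IsKerrExterior`, fact-free). [cite: AlexakisIonescuKlainerman2009, Thm. 1.1] -/
def KerrIsolation : Prop :=
  ∀ (M a r₀ : ℝ), Kerr.IsSubextremal M a → Kerr.rMinus M a < r₀ → r₀ < Kerr.rPlus M a →
    ∃ ε : ℝ, 0 < ε ∧ ∃ R : ℝ, Kerr.rPlus M a < R ∧
      ∀ 𝓑 : StationaryAFBlackHole.{0}, IsTelescopeHole 𝓑 →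
        ∀ Ψ : Kerr.region a r₀ → 𝓑.carrier, Function.Injective Ψ →
          ContMDiff 𝓘(ℝ, E4) (𝓡 4) ∞ Ψ →
          (∀ x : Kerr.region a r₀,
            mfderiv 𝓘(ℝ, E4) (𝓡 4) Ψ x (Kerr.stationaryField a r₀ x) = 𝓑.killing (Ψ x)) →
          Ψ '' {x : Kerr.region a r₀ | Kerr.rPlus M a < Kerr.radius a x.1} = 𝓑.doc →
          𝓑.toSpacetime.truncDeviationCk (kerrCollarBackground M a r₀) Ψ 3 R 0 ≤ ENNReal.ofReal ε →
          IsKerrExterior 𝓑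

/-! ## §4 The five registered stubs -/

/-- **S1 · wild data are avoidable** (`stub_wildAvoidable`; the IMPORTED ARCHITECTURE of the card — "orbital
boundedness ∧ Liouville ∧ the censorship conjunct ∧ MGHD existence" — in the one-curve escaping form that
`Disproof.genericity_not_and_closed` forces; NOT this line's mechanism).  Every admissible datum which is not
tame lies on a smooth injective admissible curve all of whose other members are tame and not Kerr-avoiding.
Internal cuts for the lead (each a pool-level input, cited by item in the line card): (a) MGHD existence —
dischargeable (shared support item stmt-9937, closed modulo the Choquet-Bruhat–Geroch named fact); (b) weak
cosmic censorship in Christodoulou's form; (c) late sequential compactness of the near-zone translates (orbital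
`C^{3,α}` boundedness incl. a horizon collar; no curvature concentration, no horizon pinching, `N` finite, holes
recede — the `LateFrame` geometry); (d) LIOUVILLE: eternal news-free tame limits are stationary and assemble into
a `StationaryAFBlackHole` with an adapted chart (far field of the limit); (e) generic third law / no extremal
creep and the D-h3 Killing field of the limit horizon (telescope); (f) the escape must land in
`Tame ∖ KerrAvoiding`, i.e. the curve's members must moreover not idle near non-Kerr holes — for wild data this
is the same fate question `stub_ejection` answers for bomb-limited ones.  Why it might fail: it contains weak
cosmic censorship and the no-breather/Liouville problem outright; codimension-`1` escapability of extremal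
thresholds (Kehle–Unger) is conjectural.  Size: open-problem (imported).  Leans on: `LateFrame.IsTame`,
`admissibleVacuumData`, `InitialDataSet.IsSmoothDataFamily`, pool items RecedingRepeller.GenericShadowing
(stmt-10084), GlobalAttraction.GenericCensorshipThirdLaw (stmt-9996), LogTimeThreeAnnuli.SubconvergentEraGeneric
(stmt-14485), EternalPapapetrou / BurnettKineticRigidity Liouville cruxes. -/
theorem stub_wildAvoidable :
    ∀ (X : Type) [TopologicalSpace X] [ChartedSpace E3 X] [IsManifold (𝓡 3) ∞ X] [T2Space X]
      [SecondCountableTopology X] [ConnectedSpace X], ∀ D ∈ admissibleVacuumData X,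
      ¬ Tame X D →
        ∃ F : EuclideanSpace ℝ (Fin 1) → InitialDataSet (𝓡 3) X,
          InitialDataSet.IsSmoothDataFamily 1 F ∧ F 0 = D ∧ Function.Injective F ∧
            (∀ c, F c ∈ admissibleVacuumData X) ∧ ∀ c, c ≠ 0 → Tame X (F c) ∧ ¬ KerrAvoiding X (F c) := by
  sorry

/-- **S2 · Kerr isolation on an anchored collar** (`stub_kerrIsolation`; THE LEVER, first half; card
`UniformKerrIsolation` retyped per triage: r1-3 (a) collar chart `Kerr.region a r₀`, r1-1 (b)/r1-2 (b) anchoring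
`Ψ({r > r₊}) = d.o.c.`, r1-1 (a)/r1-3 (b) POINTWISE in `(M, a)` — uniformity on compact parameter sets is not
needed by the clopen step and, where wanted, follows from compactness of the cluster set).  Statement:
`KerrIsolation`.  Mechanism: (i) Alexakis–Ionescu–Klainerman perturbative rigidity of smooth stationary vacuum
holes `ε̄`-close to Kerr (arXiv:0904.0982 Thm 1.1), the bifurcation sphere supplied by Rácz–Wald at `κ ≠ 0` from
the collar Killing data of the telescope (D-h3 makes the horizon Killing field available), `I⁺`-regularity from
global hyperbolicity of the telescope; (ii) THE FAR-FIELD CUT (triage r1-2 (a), honest): AIK's smallness `PK` is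
on the whole exterior slice while the hypothesis here is `C³`-closeness on ONE slab `{r ≤ R}`; closing the gap
needs an a-priori statement "a stationary vacuum AF end whose data on the sphere `r = R` are `ε`-close to Kerr's
is `Cε`-close to Kerr outside" (exterior stationary-vacuum continuation / Beig–Simon–Kennefick–Ó Murchadha
asymptotics with mass-controlled constants), OR the bypass "Kerr stability at `(M, a)` ⇒ Kerr isolated among
stationary holes near `(M, a)`" (a stationary hole is its own late-time limit), OR the reshape recorded in the
line card (strengthen `ConvergesAlong` by uniform AF constants and use AIK verbatim).  Why it might fail: (ii);
and AIK's `ε̄` degenerates as `|a| → M` (fine: pointwise).  No non-Kerr telescope hole is known, so the statement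
is unbreakable on examples (triage).  Size L.  Leans on: `kerrCollarBackground`, `Spacetime.truncDeviationCk`,
`Kerr.stationaryField`, `StationaryAFBlackHole.doc`, `IsKerrExterior`; `Literature.Barriers.FinalStateConjecture
.KillingExtensionObstruction` / `IonescuKlainermanNonExtension` (evaded: global perturbative setting with
bifurcate horizon, nothing is continued from the horizon alone); unvendored AIK 2010, Rácz–Wald 1992,
Chruściel–Costa 2008 Thm 1.3 (for the final identification). -/
theorem stub_kerrIsolation : ∀ (M a r₀ : ℝ), Kerr.IsSubextremal M a → Kerr.rMinus M a < r₀ → r₀ < Kerr.rPlus M a →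
    ∃ ε : ℝ, 0 < ε ∧ ∃ R : ℝ, Kerr.rPlus M a < R ∧
      ∀ 𝓑 : StationaryAFBlackHole.{0}, IsTelescopeHole 𝓑 →
        ∀ Ψ : Kerr.region a r₀ → 𝓑.carrier, Function.Injective Ψ →
          ContMDiff 𝓘(ℝ, E4) (𝓡 4) ∞ Ψ →
          (∀ x : Kerr.region a r₀,
            mfderiv 𝓘(ℝ, E4) (𝓡 4) Ψ x (Kerr.stationaryField a r₀ x) = 𝓑.killing (Ψ x)) →
          Ψ '' {x : Kerr.region a r₀ | Kerr.rPlus M a < Kerr.radius a x.1} = 𝓑.doc →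
          𝓑.toSpacetime.truncDeviationCk (kerrCollarBackground M a r₀) Ψ 3 R 0 ≤ ENNReal.ofReal ε →
          IsKerrExterior 𝓑 := by
  sorry

/-- **S3 · the clopen transfer at slab level** (`stub_dichotomy`; THE LEVER, second half; card's TOPOLOGY step,
merged with `bombs-open-kerr-isolated`'s "no hesitation").  Given `KerrIsolation`, for every tame late frame of
an MGHD of an admissible datum and every hole chart `i`, EITHER every cluster hole of `i` is a sub-extremal Kerr
exterior OR none is.  Mechanism: (1) CONNECTEDNESS (Hale 1980 Ch. I §8 Thm 8.1, transplanted): the curve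
`τ ↦ g_τ` of translated chart metrics is continuous into the `C³_loc`-slab uniformity and precompact by
`IsTame.subseq`, so its ω-limit set `cluster i` is compact and connected in that uniformity and
`dist(g_τ, cluster i) → 0`; (2) the Kerr locus is CLOSED in `cluster i`: a slab-`C³_loc` limit of Kerr profiles
`φ_n^* g_{M_n,a_n}` (parameters bounded by compactness, gauges `φ_n` ranging over compatible adapted charts of
Kerr, a family controlled by the anchoring) is a Kerr profile with `|a| ≤ M`, and `|a| = M` is excluded because
cluster holes are telescope holes (non-degenerate); (3) the Kerr locus is OPEN in `cluster i`: near a Kerr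
cluster profile, compose the development-independent identification of the two compatible adapted charts to
produce the anchored `T`-equivariant collar chart of `KerrIsolation` for any nearby cluster hole (compatibility
fixes domain and radius; `IsTame.telescope` gives the collar and the telescope) and apply `KerrIsolation` with
its one slab; (4) `IsPreconnected.subset_or_subset`.  Why it might fail: step (3)'s gauge bookkeeping — two
compatible adapted charts of nearby holes need not be `C³`-close as MAPS; the isolation hypothesis must be fed
the development's common chart, which is `T`-equivariant for both profiles only in the limit (stationarity of
profiles is exact, so this is bookkeeping, but it is where the anchoring clause is consumed).  Size M–L.
Leans on: `LateFrame.cluster`/`ConvergesAlong`/`IsTame`, `seqOmegaLimit` API (`LateTimeOmegaLimitSet.lean`),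
Mathlib `IsPreconnected.subset_or_subset`, `isPreconnected_iff_subset_of_disjoint`, `KerrIsolation`. -/
theorem stub_dichotomy : KerrIsolation →
    ∀ (X : Type) [TopologicalSpace X] [ChartedSpace E3 X] [IsManifold (𝓡 3) ∞ X] [T2Space X]
      [SecondCountableTopology X] [ConnectedSpace X], ∀ D ∈ admissibleVacuumData X,
      ∀ 𝒟 : VacuumCauchyDevelopment D, 𝒟.IsMaximal →
        ∀ (O : Set 𝒟.carrier) (F : LateFrame 𝒟.toSpacetime O), F.IsTame 𝒟 →
          ∀ i : Fin F.N, (∀ p ∈ F.cluster i, IsKerrExterior p.hole) ∨ (∀ p ∈ F.cluster i, ¬ IsKerrExterior p.hole) := by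
  sorry

/-- **S4 · capture on branch A = parameter pinning + chart transfer** (`stub_capture`; card `BranchA-Capture`,
here WITHOUT any Kerr-stability theorem: tameness already gives convergence to the cluster set at every
accuracy).  For an MGHD with complete `𝓘⁺` and a tame late frame ALL of whose cluster holes are sub-extremal Kerr
exteriors, the summit's settled conjunct holds: an exhaustive sub-extremal `FinalStateDecomposition … O' 2` with
`O' = exteriorOf 𝒟 d.charted`.  Mechanism: (1) by compactness of `cluster i` and continuity of `(M, a)` on the
Kerr locus the parameters met range in a compact SUB-EXTREMAL set (margin for free) and `dist(g_τ, cluster i) → 0`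
gives eventual `ε`-closeness, every `ε`, every `R`, to the Kerr family in the frame's own charts; (2) PINNING:
the connected compact continuum `cluster i` of Kerr parameters is a point — mass by the Bondi/horizon-area
budgets, spin by summability of the absorbed angular-momentum flux (the content of
LogTimeThreeAnnuli.DyadicCapture, stmt-14483, in ω-limit form) — and the gauges `φ` along the cluster are pinned
by the anchoring; (3) Kerr chart transfer: re-adapt hole chart `i` by the (now fixed) identification
`φ⁻¹ ∘ (Kerr–Schild chart)` to get `truncDeviationCk (boostedKerrBackground …) → 0`, keep flat chart, excision,
separation and covering of the frame verbatim (`FinalStateDecompositionOver` shape ⇒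
`StationaryFinalStateDecomposition.toFinalStateDecomposition`), `C³ ⇒ C²` (`FinalStateDecomposition.ofLE`),
exhaustiveness from `IsTame.exhaustive`.  Why it might fail: (2) — `(Mᵢ, |aᵢ|)` may wander along an arc of Kerr
parameters with no sign-definite spin budget (superradiant exchange `δM = Ω_H δJ`); then the summit's
fixed-parameter decomposition fails although every limit is exactly Kerr.  The stub is POINTWISE in the datum
by necessity (the class one escapes INTO must be pointwise good, else the one-curve argument regresses), as the
pool's capture items stmt-10081 / stmt-14483 are.  Size L.  Leans on:
`StationaryFinalStateDecomposition.toFinalStateDecomposition`, `hasExhaustiveCharts_toFinalStateDecomposition`,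
`FinalStateDecomposition.ofLE`, `QuasiFinalStateDecomposition`, `Summit.FinalStateConjecture.HasExhaustiveCharts`,
`BondiMass`/`EventHorizonAreaLaw` vocabulary. -/
theorem stub_capture :
    ∀ (X : Type) [TopologicalSpace X] [ChartedSpace E3 X] [IsManifold (𝓡 3) ∞ X] [T2Space X]
      [SecondCountableTopology X] [ConnectedSpace X], ∀ D ∈ admissibleVacuumData X,
      ∀ 𝒟 : VacuumCauchyDevelopment D, 𝒟.IsMaximal →
        Summit.FinalStateConjecture.HasCompleteNullInfinity 𝒟.toCauchyDevelopment →
        ∀ (O : Set 𝒟.carrier) (F : LateFrame 𝒟.toSpacetime O), F.IsTame 𝒟 →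
          (∀ i : Fin F.N, ∀ p ∈ F.cluster i, IsKerrExterior p.hole) →
          ∃ (O' : Set 𝒟.carrier) (d : FinalStateDecomposition 𝒟.toSpacetime O' 2),
            (∀ i, Kerr.IsSubextremal (d.mass i) (d.spin i)) ∧
              O' = Summit.FinalStateConjecture.exteriorOf 𝒟.toCauchyDevelopment d.charted ∧
                Summit.FinalStateConjecture.HasExhaustiveCharts d := by
  sorry

/-- **S5 · ejection from a compact family of bombs** (`stub_ejection`; card `BranchB-Ejection`, the HARDEST stub
and the consumer of `KerrOrBomb`'s output).  A bomb-limited admissible datum — some MGHD idles forever, on one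
hole component, near a compact connected family of telescope holes none of which is Killing-mode stable — is
escapable: it lies on a smooth injective admissible curve all of whose other members are tame and NOT
Kerr-avoiding.  Internal cuts (one per panel card; the lead splits here first): (a) UNIFORM INSTABILITY: growing
Killing modes persist under slab-`C³_loc` limits of telescope holes (holomorphic Fredholm families `P_n(s) → P(s)`
on a fixed collar chart, Re `s > 0`; = `bombs-open-kerr-isolated` B1 = this card's falsifier (2)), so the top rate
`ν₁` is lower semicontinuous and `≥ ν₀ > 0` on the compact cluster set; (b) TRANSVERSALITY: a compactly supported
VACUUM (constraint-solving) kick of the datum with non-zero top-mode coefficient, transported to `t = 0` by the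
conserved symplectic current (`symplectic-dual-of-the-bomb`, Lorentzian/Cauchy-slab retyping per triage);
(c) LOCKED EJECTION: strong-unstable shadowing over the idling era + flat phase-locking `c = e^{-1/s²}` so that
EVERY `c ≠ 0` member leaves the `ε₀/2`-neighbourhood of the bomb family (`one-locked-explosion`; needs the
spectral gap below `ν₁` and TopModeGap/simplicity); (d) FATE: ejected developments are tame and do not idle near
non-Kerr holes again (Bondi toll makes bomb-to-bomb chains finite; openness of the good set near the explosion's
endpoint — the near-zone-vs-weighted-norm gap lives here); (e) THE BRIDGE (Disproof §6 note 1): the instability is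
typed for the SCALAR `□_g`; converting a scalar Killing bomb into a gravitational unstable direction
(`SpinRaisingBridge` with horizon-regularity/outgoing clauses, or the spin-blind Γ₀ factorisation
`WhitingFromGeometry`) is load-bearing and untestable today (no non-Kerr telescope hole is known).  Why it might
fail: (e) — a scalar-unstable but gravitationally stable vacuum hole makes `KerrOrBomb` true and this stub false;
(d) for gapless towers `ν_m ↓ 0`.  Size XL / open.  Leans on: `BombLimited`, `Escapable`,
`StationaryAFBlackHole.not_isKillingModeStable_iff`, `IsKillingModePair`, `Genericity.lean`
(`IsSmoothDataFamily.of_eventuallyEq_zero`, `SmoothDataFamilyLocal.lean`), `ConstraintFamilies.lean`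
(`exists_smoothFamily_constraints`), `LinearizedRicci.lean`, Ideator sketches `LocalEscapeSuffices`,
`FlatPhaseLocking`, `SpinRaisingBridge` (SketchIdeator1.lean), `Sketch-r1-k2.lean` §CardA/§CardB. -/
theorem stub_ejection :
    ∀ (X : Type) [TopologicalSpace X] [ChartedSpace E3 X] [IsManifold (𝓡 3) ∞ X] [T2Space X]
      [SecondCountableTopology X] [ConnectedSpace X], ∀ D ∈ admissibleVacuumData X,
      BombLimited X D →
        ∃ F : EuclideanSpace ℝ (Fin 1) → InitialDataSet (𝓡 3) X,
          InitialDataSet.IsSmoothDataFamily 1 F ∧ F 0 = D ∧ Function.Injective F ∧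
            (∀ c, F c ∈ admissibleVacuumData X) ∧ ∀ c, c ≠ 0 → Tame X (F c) ∧ ¬ KerrAvoiding X (F c) := by
  sorry

/-! ## §5 Proved glue -/

section Glue

variable {X : Type} [TopologicalSpace X] [ChartedSpace E3 X] [IsManifold (𝓡 3) ∞ X] [T2Space X]
  [SecondCountableTopology X] [ConnectedSpace X]

omit [T2Space X] [SecondCountableTopology X] in
/-- **Where `KerrOrBomb` is consumed** (proved; the card's `kerrAvoiding_limits_are_bombs` at datum level): on the
Kerr-avoiding branch every cluster hole of the avoiding component is a telescope hole (tameness) which is not a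
Kerr exterior, hence — contrapositive of the target — not Killing-mode stable: the datum is bomb-limited.
[folklore] -/
theorem bombLimited_of_kerrAvoiding (hKOB : KerrOrBomb) {D : InitialDataSet (𝓡 3) X}
    (h : KerrAvoiding X D) : BombLimited X D := by
  obtain ⟨𝒟, hmax, O, F, hF, i, hi⟩ := h
  refine ⟨𝒟, hmax, O, F, hF, i, fun p hp ↦ ?_⟩
  intro inst hstable
  obtain ⟨hRic, hconn, hnd, hgh, hT⟩ := (hF.telescope i p hp).1
  exact hi p hp (hKOB p.hole hRic hconn hnd hgh hT hstable)

/-- **Tame and not Kerr-avoiding ⇒ good** (proved from S2–S4): for every MGHD take a tame frame; by the dichotomy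
each cluster component is all-Kerr or all-non-Kerr, and the latter would make the datum Kerr-avoiding; so all
cluster holes are Kerr and capture yields the settled conjunct; complete `𝓘⁺` and MGHD existence are part of
tameness. [folklore] -/
theorem good_of_tame_of_not_kerrAvoiding (h₂ : KerrIsolation) (h₃ : type_of% stub_dichotomy)
    (h₄ : type_of% stub_capture) {D : InitialDataSet (𝓡 3) X} (hD : D ∈ admissibleVacuumData X)
    (ht : Tame X D) (hna : ¬ KerrAvoiding X D) : Good X D := by
  refine ⟨ht.1, fun 𝒟 hmax ↦ ?_⟩
  obtain ⟨hscri, O, F, hF⟩ := ht.2 𝒟 hmax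
  refine ⟨hscri, ?_⟩
  have hK : ∀ i : Fin F.N, ∀ p ∈ F.cluster i, IsKerrExterior p.hole := by
    intro i
    rcases h₃ h₂ X D hD 𝒟 hmax O F hF i with h | h
    · exact h
    · exact absurd ⟨𝒟, hmax, O, F, hF, i, h⟩ hna
  exact h₄ X D hD 𝒟 hmax hscri O F hF hK

/-- **Composition** (kernel-checked, sorry-free): `KerrOrBomb` and the five stub statements imply the summit.
Fix a slice and a bad admissible datum `D`.  If `D` is not tame, S1 gives an admissible curve into
`Tame ∖ KerrAvoiding`; if `D` is tame it must be Kerr-avoiding (else it would be good), hence bomb-limited by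
`KerrOrBomb`, and S5 gives the curve; either way the curve's non-zero members are good by
`good_of_tame_of_not_kerrAvoiding` (S2–S4). [folklore] -/
theorem finalStateConjecture_of (hKOB : KerrOrBomb)
    (h₁ : type_of% stub_wildAvoidable)
    (h₂ : type_of% stub_kerrIsolation)
    (h₃ : type_of% stub_dichotomy)
    (h₄ : type_of% stub_capture)
    (h₅ : type_of% stub_ejection) :
    _root_.FinalStateConjecture := by
  intro X _ _ _ _ _ _ D hD
  obtain ⟨hD, hbad⟩ := hD
  have hesc : Escapable X D := by
    by_cases ht : Tame X D
    · have hav : KerrAvoiding X D := by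
        by_contra hna
        exact hbad (good_of_tame_of_not_kerrAvoiding h₂ h₃ h₄ hD ht hna)
      exact h₅ X D hD (bombLimited_of_kerrAvoiding hKOB hav)
    · exact h₁ X D hD ht
  obtain ⟨F, hF, hF0, hinj, hadm, hgood⟩ := hesc
  refine ⟨F, hF, hF0, hinj, hadm, fun c hc hmem ↦ ?_⟩
  exact hmem.2 (good_of_tame_of_not_kerrAvoiding h₂ h₃ h₄ (hadm c) (hgood c hc).1 (hgood c hc).2)

end Glue

/-! ## §6 The skeleton's concluding theorem BY NAME -/

/-- **`StationaryLimitReduction_of`**: the five stub statements imply the crux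
`ZeroEnergyKerrOrBomb.StationaryLimitReduction` (type literally the route decl; its hypothesis `KerrOrBomb` is
consumed by `bombLimited_of_kerrAvoiding`). [folklore] -/
theorem StationaryLimitReduction_of
    (h₁ : type_of% stub_wildAvoidable)
    (h₂ : type_of% stub_kerrIsolation)
    (h₃ : type_of% stub_dichotomy)
    (h₄ : type_of% stub_capture)
    (h₅ : type_of% stub_ejection) :
    Summit.FinalStateConjecture.FinalStateConjecture.Theses.ZeroEnergyKerrOrBomb.StationaryLimitReduction :=
  fun hKOB ↦ finalStateConjecture_of hKOB h₁ h₂ h₃ h₄ h₅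

/-- The crux from the stubs themselves (becomes a closed proof of stmt-FinalStateConjecture-10021 once the five
stubs land). [folklore] -/
theorem stationaryLimitReduction :
    Summit.FinalStateConjecture.FinalStateConjecture.Theses.ZeroEnergyKerrOrBomb.StationaryLimitReduction :=
  StationaryLimitReduction_of stub_wildAvoidable stub_kerrIsolation stub_dichotomy stub_capture stub_ejection

end Summit.FinalStateConjecture.FinalStateConjecture.Cruxes.StationaryLimitReduction.KerrAvoidanceDichotomy

end
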